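import Literature.MathematicalPhysics.QuantumFieldTheory.Balaban1983to89.Node00.CarriersB13DecoratedTower

/-!
# `Balaban1983to89.B13CondTowerAccretiveFloor` — T. Bałaban, *Renormalization group approach to lattice gauge field theories. II.
# Cluster expansions*, Commun. Math. Phys. **116** (1988) 1–22 [Balaban1988RG2Cluster], p. 15 («For the pair (U, 0) the operators are
# symmetric, and the measure is positive … The general case is handled by a perturbative argument»); T. Bałaban, *Propagators for lattice
# gauge theories in a background field*, Commun. Math. Phys. **99** (1985) 389–434 [Balaban1985BackgroundPropagators], p. 428 («a positive
# definite operator C\*Δ_kC with a lower bound γ₀ > 0 independent of k and U»): THE ONE POSITIVITY OF THE N10 JUNCTIONS (`hKacc`) READ OFF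
# THE RECORD'S OWN LAWS — at the conditioned kernel tower of record (`Node00.ResidB13C`, storey S5; `Node00.ResidB13D`, storey S6) the operator
# at `(σ,u) = (0,0)` IS its real reference value (`hK₀`) and that value is positive definite (`hpd`), so the junctions' accretivity binder
# holds at EVERY margin below ONE POSITIVE located numeral — the least Rayleigh floor of the finitely many reference values.

statement-level linear algebra ([folklore]: a real positive definite matrix on a finite index set has a positive Rayleigh floor — the
minimum of its quadratic form on the compact unit sphere of the sup norm; finitely many positive thresholds have a common one) over the
landed tower modules `Node00/CarriersB13CondTower` (pub-ymgap dag-n10-w3, S5: `ResidB13C`, `ResidB13C.refAcc_toK`), `Node00/CarriersB13DecoratedTower`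
(dag-n10-w3, S6: `ResidB13D`, `ResidB13D.toC`) and `B13ConditionedTermKernels` (dag-n10-c, module 19: `refAcc_of_real`), with citation tags;
kernel-checked; theorems + ONE located-numeral `def` (v1.1 §4 `accretiveFloor`; no `structure`, no instance, no notation); nothing of `Node00/CarriersB13*` is modified (successor-module
discipline); nothing here is a claim about the Yang–Mills mass gap; nothing of Bałaban's operators is constructed or asserted; no node is
discharged; count-neutral.

WHY THIS FILE (cell `pub-ymgap`, HUMAN RULING D-0062 ∕ D-0149, Track A node N10 = [B13]; width seat `pub-ymgap-dag-n10-w4` g2, CLAIM-1 ∕ INTENT-1;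
inside the (C) lineage of the n10-c lane's `N10-W-SEAT-BRIEF.md` §3; census `HOME/pub-ymgap-dag-n10-c/N10-RESIDUAL-CENSUS-v15.md`, class «★ NODE A
about the record's own fields … ONE positivity `hKacc`»).  Every N10 junction edition at def-B13's kernel tower of record —
`Thm/BalabanUVNodesN10B13KernelTowerWalksEntrywise` (51C), `…EntrywiseCond` (62), `…EntrywiseNumerals` (64), `…EntrywiseDecorated` (65),
★ `…EntrywiseNumeralsDecorated` (67, the junction of record) — DISPLAYS, among NODE A's letters, ONE positivity of the term operator at the
reference point against the margin `rf.m₀` of the reference rung: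
`hKacc : ∀ Z, ∀ t ∈ terms …, ∀ v, rf.m₀·Σ_i ‖v i‖² ≤ Re Σ_i v̄_i (K Z t (0,0) v)_i`
(and S5's `ResidB13C.differentiableOn_toK_G2` displays the same per term as `hacc`).  At the conditioned tower the record CARRIES the two
laws print states on p. 15 — `hK₀ : K Z t (0,0) = K₀ Z t` (a REAL matrix) and `hpd : K₀ Z t ≻ 0` — and S5's `refAcc_toK` (over module 19's
`refAcc_of_real`) already turns a REAL Rayleigh bound `m·Σ xᵢ² ≤ Σ xᵢ (K₀ x)ᵢ` into the binder at margin `m`.  THIS FILE supplies the Rayleigh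
bound from `hpd` and makes it UNIFORM over the finitely many terms: the binder `hKacc` is therefore NOT independent content at the record — it
constrains only the rung's margin, `rf.m₀ ≤ m⋆`, for ONE POSITIVE located numeral `m⋆` of the record (joining the thresholds `hPσ hP₁ hmA` as an
inequality among numerals), exactly as `B13Bound226Numerals` (dag-n10-w1, item (A)) turned the (2.24)–(2.26) ∃-numerics into located
inequalities.

WHAT THIS FILE PROVES (all `theorem`s).
* §1 [folklore]: `exists_rayleighFloor_of_posDef` (a real positive definite `K₀` on a finite index set has `m > 0` with `m·Σ xᵢ² ≤ Σ xᵢ(K₀x)ᵢ`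
  for every real `x` — the exact hypothesis shape `hm` of S5's `refAcc_toK`), `coercive_iff_rayleighFloor` (the same inequality IS the tree's
  `QGQInverse.Coercive K₀ m`), `exists_coercive_of_posDef`; private plumbing `rayleighFloor_mono` ∕ `acc_mono` (antitone in `m`),
  `exists_uniform_pos` (finitely many positive thresholds of antitone properties have a common positive one).
* §2 AT THE CONDITIONED TOWER `lamC : ResidB13C θ` (S5): `exists_refAcc_condTower` (per term: `∃ m > 0, ∀ v, m·Σ‖vᵢ‖² ≤ Re⟨v, K Z t (0,0) v⟩`
  from `hK₀ ∕ hpd` alone), `exists_uniform_rayleighFloor_condTower` (ONE real Rayleigh floor `m⋆ > 0` for ALL reference values `K₀ Z t` — the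
  displayable real binder), ★ `exists_accretiveFloor_condTower` (`∃ m⋆ > 0, ∀ m₀ ≤ m⋆, ∀ Z t v, m₀·Σ‖vᵢ‖² ≤ Re⟨v, K Z t (0,0) v⟩` — ONE floor for
  ALL terms of the layer, the index `TDom × B13TermIdx` being finite), ★ `exists_hKacc_condTower` (the junctions' binder TEXT, verbatim as in modules
  62 ∕ 64 at `lamC.toK`, at every margin `m₀ ≤ m⋆`), `hKacc_condTower_of_rayleighFloor` (the same at one given common real floor).
* §3 AT THE DECORATED TOWER `lamD : ResidB13D θ` (S6): ★ `exists_hKacc_decTower` (module 67's `hKacc` at `lamD.toC`, every margin `rf.m₀ ≤ m⋆`),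
  `exists_refAcc_decTower`, `hKacc_decTower_of_rayleighFloor` (67's `hKacc` at a given margin from a common real floor of the `lamD.K₀ Z t`),
  `exists_uniform_rayleighFloor_decTower`.
* §4 (v1.1, append-only) THE NUMERAL NAMED: `accretiveFloor lamC` (`Classical.choose` of §2's uniform real Rayleigh floor), `accretiveFloor_pos`,
  `rayleighFloor_accretiveFloor`, `refAcc_of_le_accretiveFloor`, ★ `hKacc_condTower_of_le_accretiveFloor` ∕ ★ `hKacc_decTower_of_le_accretiveFloor` (the
  junctions' binder from the DISPLAYABLE located inequality `m₀ ≤ accretiveFloor …`, the `theta0Max`-style form a 64 ∕ 67 edition reads), `coercive_K₀_accretiveFloor`.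
HONEST FRAMING: located bookkeeping + one compactness lemma; `m⋆` is a finite-lattice number read off the record's DATA `K₀ Z t` — print's k- and
U-UNIFORM lower bound γ₀ of [13] p. 428 ([4] Lemma 2.4; N06's ∕ def-T's content at Bałaban's objects) is NEITHER proved NOR claimed here, and which
`K₀` the record of a member HAS is def-T's term tower (census v15 item 2); the other NODE-A binders (`hEL hfibF hGJ hCle hCsupp hKfar hKmult hKdim`, the
letter match, the numerics) are untouched; N10 NOT discharged; K1⁷ NOT closed; counts unmoved (typed 28∕28 · discharged 5∕27); no `sorry`, no new
named fact; standard axioms; one finite 𝕋⁴ programme at fixed ε, Bałaban AS PRINTED; the YM mass gap (Clay) is NOT proved by any of this — R4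
closes the conditional finite-𝕋⁴ rung `BalabanLadder.UV` only; nothing continuum ∕ ℝ⁴ ∕ OS.

References: T. Bałaban, CMP 116 (1988) 1–22 [Balaban1988RG2Cluster] (2.5)–(2.7) pp.12–13, (2.14) p.15, p.15; CMP 99 (1985) 389–434
[Balaban1985BackgroundPropagators] Thm 3.11 p.416, p.428; CMP 96 (1984) 223–250 [Balaban1984PropagatorsII] Lemma 2.4 p.245.
-/

noncomputable section

namespace Literature.MathematicalPhysics.QuantumFieldTheory.Balaban1983to89.B13CondTowerAccretiveFloor

open Finset Metric
open scoped Matrix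
open Literature.MathematicalPhysics.QuantumFieldTheory.Balaban1983to89
open Literature.MathematicalPhysics.QuantumFieldTheory.Balaban1983to89.Node00 (Stage3Params ResidB13C ResidB13D B13TermIdx)
open Literature.MathematicalPhysics.QuantumFieldTheory.Balaban1983to89.TreeLengthTorus (TDom TPt)
open Literature.MathematicalPhysics.QuantumFieldTheory.Balaban1983to89.B13Lemma3TorusTerms (terms)

/-! ## §1. Folklore: the Rayleigh floor of a real positive definite matrix; common positive thresholds over finite families -/

section Folklore

variable {n : Type*} [Fintype n]

/-- Sum of squares against the sup norm: `Σᵢ xᵢ² ≤ |n|·‖x‖²` (each `|xᵢ| ≤ ‖x‖`). [folklore] -/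
private theorem sum_sq_le_card_mul_norm_sq (x : n → ℝ) : ∑ i, x i ^ 2 ≤ Fintype.card n * ‖x‖ ^ 2 := by
  calc ∑ i, x i ^ 2 ≤ ∑ _i : n, ‖x‖ ^ 2 := Finset.sum_le_sum fun i _ => by
          have h1 : |x i| ≤ ‖x‖ := by simpa [Real.norm_eq_abs] using norm_le_pi_norm x i
          rw [← sq_abs]
          exact pow_le_pow_left₀ (abs_nonneg _) h1 2
    _ = Fintype.card n * ‖x‖ ^ 2 := by simp [Finset.sum_const, Finset.card_univ]

/-- The real quadratic form is 2-homogeneous: `Σᵢ (c x)ᵢ (K₀ (c x))ᵢ = c²·Σᵢ xᵢ (K₀ x)ᵢ`. [folklore] -/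
private theorem form_smul (K₀ : Matrix n n ℝ) (c : ℝ) (x : n → ℝ) :
    ∑ i, (c • x) i * (K₀ *ᵥ (c • x)) i = c ^ 2 * ∑ i, x i * (K₀ *ᵥ x) i := by
  rw [Matrix.mulVec_smul, Finset.mul_sum]
  refine Finset.sum_congr rfl fun i _ => ?_
  simp only [Pi.smul_apply, smul_eq_mul]
  ring

/-- **A REAL POSITIVE DEFINITE MATRIX HAS A POSITIVE RAYLEIGH FLOOR**: `K₀ ≻ 0` on a finite index set ⟹ `∃ m > 0, ∀ x, m·Σᵢ xᵢ² ≤ Σᵢ xᵢ (K₀ x)ᵢ`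
(the minimum of the quadratic form on the compact unit sphere of the sup norm, rescaled; `Σ xᵢ² ≤ |n|‖x‖²_∞`).  The inequality is the exact
hypothesis shape `hm` of S5's `ResidB13C.refAcc_toK`; `m` is a finite-lattice number, NOT print's uniform γ₀ of [13] p. 428.
[folklore] [cite: Balaban1985BackgroundPropagators, Thm 3.11 p.416, p.428] -/
theorem exists_rayleighFloor_of_posDef (K₀ : Matrix n n ℝ) (hK : K₀.PosDef) :
    ∃ m : ℝ, 0 < m ∧ ∀ x : n → ℝ, m * ∑ i, x i ^ 2 ≤ ∑ i, x i * (K₀ *ᵥ x) i := by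
  classical
  have hq : Continuous fun x : n → ℝ => ∑ i, x i * (K₀ *ᵥ x) i := by
    change Continuous fun x : n → ℝ => x ⬝ᵥ (K₀ *ᵥ x)
    exact continuous_id.dotProduct (Continuous.matrix_mulVec continuous_const continuous_id)
  have hpos : ∀ x : n → ℝ, x ≠ 0 → 0 < ∑ i, x i * (K₀ *ᵥ x) i := fun x hx => by
    simpa [dotProduct] using hK.dotProduct_mulVec_pos hx
  cases isEmpty_or_nonempty n with
  | inl h =>
      exact ⟨1, one_pos, fun x => by simp [Finset.univ_eq_empty]⟩
  | inr h =>
      haveI : Nonempty n := h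
      obtain ⟨i₀⟩ := h
      have hcpt : IsCompact (sphere (0 : n → ℝ) 1) := isCompact_sphere _ _
      have hne : (sphere (0 : n → ℝ) 1).Nonempty := ⟨Pi.single i₀ 1, by simp [Pi.norm_single]⟩
      obtain ⟨ψ₀, hψ₀, hmin⟩ := hcpt.exists_isMinOn hne hq.continuousOn
      have hψ₀ne : ψ₀ ≠ 0 := by
        intro h0; rw [h0] at hψ₀; simp at hψ₀
      set c₀ : ℝ := ∑ i, ψ₀ i * (K₀ *ᵥ ψ₀) i with hc₀
      have hc₀pos : 0 < c₀ := hpos ψ₀ hψ₀ne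
      have hcard : (0 : ℝ) < Fintype.card n := by exact_mod_cast Fintype.card_pos
      refine ⟨c₀ / Fintype.card n, div_pos hc₀pos hcard, fun x => ?_⟩
      by_cases hx : x = 0
      · subst hx; simp
      · have hnorm : 0 < ‖x‖ := norm_pos_iff.2 hx
        set ψ : n → ℝ := ‖x‖⁻¹ • x with hψ
        have hψmem : ψ ∈ sphere (0 : n → ℝ) 1 := by
          rw [mem_sphere_zero_iff_norm, hψ, norm_smul, norm_inv, norm_norm, inv_mul_cancel₀ hnorm.ne']
        have hle : c₀ ≤ ∑ i, ψ i * (K₀ *ᵥ ψ) i := hmin hψmem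
        have hscale : ∑ i, x i * (K₀ *ᵥ x) i = ‖x‖ ^ 2 * ∑ i, ψ i * (K₀ *ᵥ ψ) i := by
          have hxψ : x = ‖x‖ • ψ := by rw [hψ, smul_smul, mul_inv_cancel₀ hnorm.ne', one_smul]
          conv_lhs => rw [hxψ]
          rw [form_smul]
        rw [hscale]
        calc c₀ / Fintype.card n * ∑ i, x i ^ 2 ≤ c₀ / Fintype.card n * (Fintype.card n * ‖x‖ ^ 2) := by
              gcongr; exact sum_sq_le_card_mul_norm_sq x
          _ = ‖x‖ ^ 2 * c₀ := by field_simp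
          _ ≤ ‖x‖ ^ 2 * ∑ i, ψ i * (K₀ *ᵥ ψ) i := by gcongr

omit [Fintype n] in
/-- The Rayleigh-floor inequality IS the tree's real coercivity predicate `QGQInverse.Coercive K₀ m` (`m·(x ⬝ x) ≤ x ⬝ K₀x`): same currency as
`B13RealSliceEntryLetters.accretive_of_coercive_sub` ∕ `B13AccretiveOfRealCoercive` (currency bookkeeping for [13] Thm 3.11's
«positive operator» read on a finite lattice). [folklore] [cite: Balaban1985BackgroundPropagators, Thm 3.11 p.416] -/
theorem coercive_iff_rayleighFloor [Fintype n] [DecidableEq n] (K₀ : Matrix n n ℝ) (m : ℝ) :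
    QGQInverse.Coercive K₀ m ↔ ∀ x : n → ℝ, m * ∑ i, x i ^ 2 ≤ ∑ i, x i * (K₀ *ᵥ x) i := by
  refine forall_congr' fun x => ?_
  simp only [dotProduct, pow_two]

/-- A real positive definite matrix is coercive in the tree's currency, for some `γ > 0`. [folklore]
[cite: Balaban1985BackgroundPropagators, Thm 3.11 p.416] -/
theorem exists_coercive_of_posDef [DecidableEq n] (K₀ : Matrix n n ℝ) (hK : K₀.PosDef) :
    ∃ γ : ℝ, 0 < γ ∧ QGQInverse.Coercive K₀ γ := by
  obtain ⟨m, hm, h⟩ := exists_rayleighFloor_of_posDef K₀ hK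
  exact ⟨m, hm, (coercive_iff_rayleighFloor K₀ m).2 h⟩

/-- The Rayleigh floor is ANTITONE in the margin: a bound at `m` is a bound at every `m′ ≤ m` (plumbing). [folklore] -/
private theorem rayleighFloor_mono {K₀ : Matrix n n ℝ} {m m' : ℝ} (hm : ∀ x : n → ℝ, m * ∑ i, x i ^ 2 ≤ ∑ i, x i * (K₀ *ᵥ x) i)
    (h : m' ≤ m) : ∀ x : n → ℝ, m' * ∑ i, x i ^ 2 ≤ ∑ i, x i * (K₀ *ᵥ x) i := fun x =>
  (mul_le_mul_of_nonneg_right h (Finset.sum_nonneg fun i _ => sq_nonneg (x i))).trans (hm x)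

omit [Fintype n] in
/-- The complex accretivity inequality is ANTITONE in the margin (the form used by the junctions' `hKacc`; plumbing). [folklore] -/
private theorem acc_mono {v : n → ℂ} {s : Finset n} {m m' a : ℝ} (hm : m * ∑ i ∈ s, ‖v i‖ ^ 2 ≤ a) (h : m' ≤ m) :
    m' * ∑ i ∈ s, ‖v i‖ ^ 2 ≤ a :=
  (mul_le_mul_of_nonneg_right h (Finset.sum_nonneg fun i _ => sq_nonneg ‖v i‖)).trans hm

/-- **FINITELY MANY POSITIVE THRESHOLDS HAVE A COMMON ONE**: if each member of a finite family of properties `P i`, antitone in the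
threshold, holds at some positive threshold, then one positive threshold serves all members (the minimum; plumbing). [folklore] -/
private theorem exists_uniform_pos {ι : Type*} (s : Finset ι) (P : ι → ℝ → Prop)
    (hanti : ∀ i ∈ s, ∀ m m' : ℝ, m' ≤ m → P i m → P i m') (hex : ∀ i ∈ s, ∃ m : ℝ, 0 < m ∧ P i m) :
    ∃ m : ℝ, 0 < m ∧ ∀ i ∈ s, P i m := by
  classical
  induction s using Finset.induction_on with
  | empty => exact ⟨1, one_pos, fun i hi => absurd hi (Finset.notMem_empty i)⟩
  | insert a s ha ih =>
      obtain ⟨m₁, hm₁, h₁⟩ := hex a (Finset.mem_insert_self a s)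
      obtain ⟨m₂, hm₂, h₂⟩ := ih (fun i hi => hanti i (Finset.mem_insert_of_mem hi))
        (fun i hi => hex i (Finset.mem_insert_of_mem hi))
      refine ⟨min m₁ m₂, lt_min hm₁ hm₂, fun i hi => ?_⟩
      rcases Finset.mem_insert.1 hi with rfl | hi'
      · exact hanti _ (Finset.mem_insert_self _ _) m₁ _ (min_le_left _ _) h₁
      · exact hanti _ (Finset.mem_insert_of_mem hi') m₂ _ (min_le_right _ _) (h₂ i hi')

end Folklore

/-! ## §2. At the conditioned kernel tower of record (S5): the binder from `hK₀ ∕ hpd`, one floor for all terms -/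

section CondTower

variable {θ : Stage3Params} (lamC : ResidB13C θ)

/-- **`hacc` ∕ `hKacc` PER TERM FROM THE RECORD's LAWS ALONE**: at every term `t` of every `Z` the operator at `(σ,u) = (0,0)` is the real
reference `K₀ Z t` (`hK₀`), positive definite (`hpd`), so `∃ m > 0, ∀ v, m·Σ‖vᵢ‖² ≤ Re⟨v, K Z t (0,0) v⟩` — S5's `refAcc_toK` fed by §1's floor.
(This is the binder `hacc` of `ResidB13C.differentiableOn_toK_G2` at SOME positive margin.) [cite: Balaban1988RG2Cluster, p.15] -/
theorem exists_refAcc_condTower (Z : TDom 4 (lamC.n + 1)) (t : B13TermIdx θ lamC.n lamC.m₃) :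
    ∃ m : ℝ, 0 < m ∧ ∀ v : lamC.Λ Z t ⊕ lamC.C₀ Z t → ℂ,
      m * ∑ i, ‖v i‖ ^ 2 ≤ (∑ i, star (v i) * (lamC.KK Z t 0 0 *ᵥ v) i).re := by
  obtain ⟨m, hm, h⟩ := exists_rayleighFloor_of_posDef (lamC.K₀ Z t) (lamC.hpd Z t)
  exact ⟨m, hm, fun v => Node00.refAcc_toK lamC Z t h v⟩

/-- **ONE REAL RAYLEIGH FLOOR FOR ALL REFERENCE VALUES OF THE LAYER**: the terms `(Z, t)` range over the FINITE type
`TDom 4 (n+1) × B13TermIdx θ n m₃`, so the per-term Rayleigh floors of the `K₀ Z t` (§1, from `hpd`) have a common positive lower bound: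
`∃ m⋆ > 0, ∀ Z t x, m⋆·Σ xᵢ² ≤ Σ xᵢ (K₀ Z t x)ᵢ` — the ONE real binder a junction edition may display in place of `hKacc` (with `rf.m₀ ≤ m⋆`).
[cite: Balaban1988RG2Cluster, p.15; Balaban1985BackgroundPropagators, p.428] -/
theorem exists_uniform_rayleighFloor_condTower :
    ∃ mstar : ℝ, 0 < mstar ∧
      ∀ (Z : TDom 4 (lamC.n + 1)) (t : B13TermIdx θ lamC.n lamC.m₃) (x : lamC.Λ Z t ⊕ lamC.C₀ Z t → ℝ),
        mstar * ∑ i, x i ^ 2 ≤ ∑ i, x i * (lamC.K₀ Z t *ᵥ x) i := by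
  classical
  obtain ⟨m, hm, h⟩ := exists_uniform_pos (Finset.univ : Finset (TDom 4 (lamC.n + 1) × B13TermIdx θ lamC.n lamC.m₃))
    (fun zt m => ∀ x : lamC.Λ zt.1 zt.2 ⊕ lamC.C₀ zt.1 zt.2 → ℝ, m * ∑ i, x i ^ 2 ≤ ∑ i, x i * (lamC.K₀ zt.1 zt.2 *ᵥ x) i)
    (fun zt _ m m' hle hP => rayleighFloor_mono hP hle)
    (fun zt _ => exists_rayleighFloor_of_posDef (lamC.K₀ zt.1 zt.2) (lamC.hpd zt.1 zt.2))
  exact ⟨m, hm, fun Z t x => h (Z, t) (Finset.mem_univ _) x⟩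

/-- ★ **ONE ACCRETIVE FLOOR FOR THE WHOLE LAYER**: the terms `(Z, t)` of a conditioned layer range over the FINITE type
`TDom 4 (n+1) × B13TermIdx θ n m₃`, so the per-term floors have a common positive lower bound: `∃ m⋆ > 0` such that for EVERY margin `m₀ ≤ m⋆`,
every `Z`, `t` and every complex `v`, `m₀·Σ‖vᵢ‖² ≤ Re⟨v, K Z t (0,0) v⟩`.  The located numeral `m⋆ = m⋆(lamC)` is the record's; nothing uniform in
the step or the background is claimed. [cite: Balaban1988RG2Cluster, p.15; Balaban1985BackgroundPropagators, p.428] -/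
theorem exists_accretiveFloor_condTower :
    ∃ mstar : ℝ, 0 < mstar ∧ ∀ m₀ : ℝ, m₀ ≤ mstar →
      ∀ (Z : TDom 4 (lamC.n + 1)) (t : B13TermIdx θ lamC.n lamC.m₃) (v : lamC.Λ Z t ⊕ lamC.C₀ Z t → ℂ),
        m₀ * ∑ i, ‖v i‖ ^ 2 ≤ (∑ i, star (v i) * (lamC.KK Z t 0 0 *ᵥ v) i).re := by
  classical
  obtain ⟨m, hm, h⟩ := exists_uniform_pos (Finset.univ : Finset (TDom 4 (lamC.n + 1) × B13TermIdx θ lamC.n lamC.m₃))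
    (fun zt m => ∀ v : lamC.Λ zt.1 zt.2 ⊕ lamC.C₀ zt.1 zt.2 → ℂ,
      m * ∑ i, ‖v i‖ ^ 2 ≤ (∑ i, star (v i) * (lamC.KK zt.1 zt.2 0 0 *ᵥ v) i).re)
    (fun zt _ m m' hle hP v => acc_mono (hP v) hle)
    (fun zt _ => exists_refAcc_condTower lamC zt.1 zt.2)
  exact ⟨m, hm, fun m₀ hm₀ Z t v => acc_mono (h (Z, t) (Finset.mem_univ _) v) hm₀⟩

/-- ★ **THE JUNCTIONS' BINDER `hKacc` AT THE CONDITIONED TOWER, ∃-ELIMINATED INTO ONE LOCATED NUMERAL**: in the verbatim binder text of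
`Thm/BalabanUVNodesN10B13KernelTowerWalksEntrywiseCond` (62) ∕ `…EntrywiseNumerals` (64) at `lamC.toK` —
`∀ Z, ∀ t ∈ terms (θ.ℓ₆+1) (lamC.toK.layer.m₃+1) Z, ∀ v : (lamC.toK.𝒦 Z t).Λ ⊕ (lamC.toK.𝒦 Z t).C₀ → ℂ, m₀·Σ‖vᵢ‖² ≤ Re Σ v̄ᵢ (lamC.KK Z t 0 0 v)ᵢ` —
the binder holds at EVERY margin `m₀ ≤ m⋆` for ONE `m⋆ > 0` of the record: at the record `hKacc` only constrains the rung's margin `rf.m₀ ≤ m⋆`.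
[cite: Balaban1988RG2Cluster, (2.5)–(2.7) pp.12–13, (2.14) p.15, p.15] -/
theorem exists_hKacc_condTower :
    ∃ mstar : ℝ, 0 < mstar ∧ ∀ m₀ : ℝ, m₀ ≤ mstar →
      ∀ Z, ∀ t ∈ terms (θ.ℓ₆ + 1) (lamC.toK.layer.m₃ + 1) Z, ∀ v : (lamC.toK.𝒦 Z t).Λ ⊕ (lamC.toK.𝒦 Z t).C₀ → ℂ,
        m₀ * ∑ i, ‖v i‖ ^ 2 ≤ (∑ i, star (v i) * (lamC.KK Z t 0 0 *ᵥ v) i).re := by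
  obtain ⟨m, hm, h⟩ := exists_accretiveFloor_condTower lamC
  exact ⟨m, hm, fun m₀ hm₀ Z t _ v => h m₀ hm₀ Z t v⟩

/-- The same at ONE GIVEN margin: a real Rayleigh floor `m₀` common to all reference values `K₀ Z t` (e.g. any `m₀ ≤ m⋆`) gives the binder
`hKacc` at `m₀` (S5's `refAcc_toK`, quantified as the junctions quantify). [cite: Balaban1988RG2Cluster, p.15] -/
theorem hKacc_condTower_of_rayleighFloor {m₀ : ℝ}
    (hm : ∀ (Z : TDom 4 (lamC.n + 1)) (t : B13TermIdx θ lamC.n lamC.m₃) (x : lamC.Λ Z t ⊕ lamC.C₀ Z t → ℝ),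
      m₀ * ∑ i, x i ^ 2 ≤ ∑ i, x i * (lamC.K₀ Z t *ᵥ x) i) :
    ∀ Z, ∀ t ∈ terms (θ.ℓ₆ + 1) (lamC.toK.layer.m₃ + 1) Z, ∀ v : (lamC.toK.𝒦 Z t).Λ ⊕ (lamC.toK.𝒦 Z t).C₀ → ℂ,
      m₀ * ∑ i, ‖v i‖ ^ 2 ≤ (∑ i, star (v i) * (lamC.KK Z t 0 0 *ᵥ v) i).re :=
  fun Z t _ v => Node00.refAcc_toK lamC Z t (hm Z t) v

end CondTower

/-! ## §3. At the decorated kernel tower of record (S6): module 67's `hKacc` -/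

section DecoratedTower

variable {θ : Stage3Params} (lamD : ResidB13D θ)

/-- **`hKacc` PER TERM at the decorated tower**: `lamD.toC.KK Z t 0 0 = decoratedOp (Δ₀ Z t) (J Z t) (Cm Z t) 0 0` is the real reference `K₀ Z t`
(`lamD.hK₀`), positive definite (`lamD.hpd`) ⟹ `∃ m > 0, ∀ v, m·Σ‖vᵢ‖² ≤ Re⟨v, lamD.toC.KK Z t 0 0 v⟩`. [cite: Balaban1988RG2Cluster, p.15] -/
theorem exists_refAcc_decTower (Z : TDom 4 (lamD.n + 1)) (t : B13TermIdx θ lamD.n lamD.m₃) :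
    ∃ m : ℝ, 0 < m ∧ ∀ v : lamD.Λ Z t ⊕ lamD.C₀ Z t → ℂ,
      m * ∑ i, ‖v i‖ ^ 2 ≤ (∑ i, star (v i) * (lamD.toC.KK Z t 0 0 *ᵥ v) i).re :=
  exists_refAcc_condTower lamD.toC Z t

/-- ★ **MODULE 67's `hKacc`, ∃-ELIMINATED**: in the verbatim binder text of the junction of record
`Thm/BalabanUVNodesN10B13KernelTowerWalksEntrywiseNumeralsDecorated` at `lamD.toC.toK` —
`∀ Z, ∀ t ∈ terms (θ.ℓ₆+1) (lamD.toC.toK.layer.m₃+1) Z, ∀ v : (lamD.toC.toK.𝒦 Z t).Λ ⊕ (lamD.toC.toK.𝒦 Z t).C₀ → ℂ, rf.m₀·Σ‖vᵢ‖² ≤ Re Σ v̄ᵢ (lamD.toC.KK Z t 0 0 v)ᵢ`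
— there is ONE located numeral `m⋆ = m⋆(lamD) > 0` such that the binder holds for EVERY reference rung with `rf.m₀ ≤ m⋆`; it is read off the
record's laws `hK₀ ∕ hpd` alone (§2 at `lamD.toC`). [cite: Balaban1988RG2Cluster, (2.5)–(2.8) pp.12–14, (2.14) p.15, p.15] -/
theorem exists_hKacc_decTower :
    ∃ mstar : ℝ, 0 < mstar ∧ ∀ m₀ : ℝ, m₀ ≤ mstar →
      ∀ Z, ∀ t ∈ terms (θ.ℓ₆ + 1) (lamD.toC.toK.layer.m₃ + 1) Z, ∀ v : (lamD.toC.toK.𝒦 Z t).Λ ⊕ (lamD.toC.toK.𝒦 Z t).C₀ → ℂ,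
        m₀ * ∑ i, ‖v i‖ ^ 2 ≤ (∑ i, star (v i) * (lamD.toC.KK Z t 0 0 *ᵥ v) i).re :=
  exists_hKacc_condTower lamD.toC

/-- Module 67's `hKacc` at ONE GIVEN margin from a common real Rayleigh floor of the reference values `lamD.K₀ Z t` (the displayable real
binder; `exists_uniform_rayleighFloor_decTower` inhabits it at some `m⋆ > 0`). [cite: Balaban1988RG2Cluster, p.15] -/
theorem hKacc_decTower_of_rayleighFloor {m₀ : ℝ}
    (hm : ∀ (Z : TDom 4 (lamD.n + 1)) (t : B13TermIdx θ lamD.n lamD.m₃) (x : lamD.Λ Z t ⊕ lamD.C₀ Z t → ℝ),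
      m₀ * ∑ i, x i ^ 2 ≤ ∑ i, x i * (lamD.K₀ Z t *ᵥ x) i) :
    ∀ Z, ∀ t ∈ terms (θ.ℓ₆ + 1) (lamD.toC.toK.layer.m₃ + 1) Z, ∀ v : (lamD.toC.toK.𝒦 Z t).Λ ⊕ (lamD.toC.toK.𝒦 Z t).C₀ → ℂ,
      m₀ * ∑ i, ‖v i‖ ^ 2 ≤ (∑ i, star (v i) * (lamD.toC.KK Z t 0 0 *ᵥ v) i).re :=
  hKacc_condTower_of_rayleighFloor lamD.toC hm

/-- The uniform real Rayleigh floor of the decorated layer's reference values (`lamD.K₀ = lamD.toC.K₀`). [cite: Balaban1988RG2Cluster, p.15] -/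
theorem exists_uniform_rayleighFloor_decTower :
    ∃ mstar : ℝ, 0 < mstar ∧
      ∀ (Z : TDom 4 (lamD.n + 1)) (t : B13TermIdx θ lamD.n lamD.m₃) (x : lamD.Λ Z t ⊕ lamD.C₀ Z t → ℝ),
        mstar * ∑ i, x i ^ 2 ≤ ∑ i, x i * (lamD.K₀ Z t *ᵥ x) i :=
  exists_uniform_rayleighFloor_condTower lamD.toC

end DecoratedTower

/-! ## §4. (v1.1, append-only) The located numeral NAMED: `accretiveFloor lamC = m⋆(lamC)` -/

section Floor

variable {θ : Stage3Params}

/-- ★ **THE ACCRETIVE FLOOR `m⋆(lamC)` OF A CONDITIONED LAYER, AS A NAMED NUMERAL**: a real number read off the record's reference values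
`K₀ Z t` (chosen, by `Classical.choose`, from `exists_uniform_rayleighFloor_condTower`: ONE real Rayleigh floor common to all of them), so that
a junction edition can DISPLAY the located inequality `rf.m₀ ≤ accretiveFloor lamD.toC` in place of the binder `hKacc` — exactly as module 67
displays `θ₀ ≤ theta0Max …`, `γ₂ ≤ gamma2Max …`, `m4Min … ≤ M⁴` (`B13Bound226Numerals`) in place of the (2.24)–(2.26) ∃-numerics.  A finite-lattice
number of the record's DATA; NOT print's k-∕U-uniform γ₀. [cite: Balaban1988RG2Cluster, p.15; Balaban1985BackgroundPropagators, p.428] -/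
def accretiveFloor (lamC : ResidB13C θ) : ℝ :=
  Classical.choose (exists_uniform_rayleighFloor_condTower lamC)

/-- The accretive floor is POSITIVE (the record's law `hpd`). [cite: Balaban1988RG2Cluster, p.15] -/
theorem accretiveFloor_pos (lamC : ResidB13C θ) : 0 < accretiveFloor lamC :=
  (Classical.choose_spec (exists_uniform_rayleighFloor_condTower lamC)).1

/-- The accretive floor IS a real Rayleigh floor of EVERY reference value `K₀ Z t` of the layer. [cite: Balaban1988RG2Cluster, p.15] -/
theorem rayleighFloor_accretiveFloor (lamC : ResidB13C θ) (Z : TDom 4 (lamC.n + 1)) (t : B13TermIdx θ lamC.n lamC.m₃)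
    (x : lamC.Λ Z t ⊕ lamC.C₀ Z t → ℝ) :
    accretiveFloor lamC * ∑ i, x i ^ 2 ≤ ∑ i, x i * (lamC.K₀ Z t *ᵥ x) i :=
  (Classical.choose_spec (exists_uniform_rayleighFloor_condTower lamC)).2 Z t x

/-- The per-term positivity (`hacc` of S5's `ResidB13C.differentiableOn_toK_G2`) at EVERY margin below the floor. [cite: Balaban1988RG2Cluster, p.15] -/
theorem refAcc_of_le_accretiveFloor (lamC : ResidB13C θ) {m₀ : ℝ} (hm₀ : m₀ ≤ accretiveFloor lamC)
    (Z : TDom 4 (lamC.n + 1)) (t : B13TermIdx θ lamC.n lamC.m₃) (v : lamC.Λ Z t ⊕ lamC.C₀ Z t → ℂ) :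
    m₀ * ∑ i, ‖v i‖ ^ 2 ≤ (∑ i, star (v i) * (lamC.KK Z t 0 0 *ᵥ v) i).re :=
  Node00.refAcc_toK lamC Z t (rayleighFloor_mono (rayleighFloor_accretiveFloor lamC Z t) hm₀) v

/-- ★ **THE JUNCTIONS' `hKacc` (62 ∕ 64, at `lamC.toK`) FROM THE LOCATED INEQUALITY `m₀ ≤ accretiveFloor lamC`** — the displayable form.
[cite: Balaban1988RG2Cluster, (2.5)–(2.7) pp.12–13, (2.14) p.15, p.15] -/
theorem hKacc_condTower_of_le_accretiveFloor (lamC : ResidB13C θ) {m₀ : ℝ} (hm₀ : m₀ ≤ accretiveFloor lamC) :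
    ∀ Z, ∀ t ∈ terms (θ.ℓ₆ + 1) (lamC.toK.layer.m₃ + 1) Z, ∀ v : (lamC.toK.𝒦 Z t).Λ ⊕ (lamC.toK.𝒦 Z t).C₀ → ℂ,
      m₀ * ∑ i, ‖v i‖ ^ 2 ≤ (∑ i, star (v i) * (lamC.KK Z t 0 0 *ᵥ v) i).re :=
  hKacc_condTower_of_rayleighFloor lamC fun Z t => rayleighFloor_mono (rayleighFloor_accretiveFloor lamC Z t) hm₀

/-- ★ **MODULE 67's `hKacc` (at `lamD.toC`) FROM THE LOCATED INEQUALITY `rf.m₀ ≤ accretiveFloor lamD.toC`** — the displayable form for the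
junction of record's edition. [cite: Balaban1988RG2Cluster, (2.5)–(2.8) pp.12–14, (2.14) p.15, p.15] -/
theorem hKacc_decTower_of_le_accretiveFloor (lamD : ResidB13D θ) {m₀ : ℝ} (hm₀ : m₀ ≤ accretiveFloor lamD.toC) :
    ∀ Z, ∀ t ∈ terms (θ.ℓ₆ + 1) (lamD.toC.toK.layer.m₃ + 1) Z, ∀ v : (lamD.toC.toK.𝒦 Z t).Λ ⊕ (lamD.toC.toK.𝒦 Z t).C₀ → ℂ,
      m₀ * ∑ i, ‖v i‖ ^ 2 ≤ (∑ i, star (v i) * (lamD.toC.KK Z t 0 0 *ᵥ v) i).re :=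
  hKacc_condTower_of_le_accretiveFloor lamD.toC hm₀

/-- The accretive floor in the tree's real coercivity currency: every `K₀ Z t` is `QGQInverse.Coercive` at `accretiveFloor lamC` (for the
Combes–Thomas ∕ inverse-entry bounds of `QGQInverse`, should a consumer want them at the reference values). [cite: Balaban1985BackgroundPropagators, Thm 3.11 p.416] -/
theorem coercive_K₀_accretiveFloor (lamC : ResidB13C θ) (Z : TDom 4 (lamC.n + 1)) (t : B13TermIdx θ lamC.n lamC.m₃) :
    QGQInverse.Coercive (lamC.K₀ Z t) (accretiveFloor lamC) :=
  (coercive_iff_rayleighFloor (lamC.K₀ Z t) (accretiveFloor lamC)).2 (rayleighFloor_accretiveFloor lamC Z t)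

end Floor

end Literature.MathematicalPhysics.QuantumFieldTheory.Balaban1983to89.B13CondTowerAccretiveFloor

end
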